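import Literature.NumberTheory.Sieve.SmoothMajorantEuler
import Literature.NumberTheory.Sieve.SmoothMajorantFourier
import Mathlib.Analysis.SpecialFunctions.JapaneseBracket
import Mathlib.MeasureTheory.Integral.Bochner.Set
import HarnessLib

/-!
# The smooth linear forms estimate (Conlon–Fox–Zhao Prop. 8.3): assembly steps

Trunk T-SIEVE. D. Conlon, J. Fox, Y. Zhao, *The Green–Tao theorem: an exposition*
(arXiv:1403.2957), §9. This file collects the steps of the proof of Proposition 8.3 (the named fact
`Literature.NumberTheory.Sieve.GreenTao2008.SmoothLinearFormsEstimate`, discharged in `SmoothMajorantFinal`) that combine the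
bricks of `SmoothMajorantLocal/CRT/Density/Euler/Fourier`; everything here is proved. Equation
numbers are the printed global display numbers (28)–(38) of §9 (earlier files of this series wrote
"(9.n)" for display (27+n)):

* (S2-link, p. 17, (28)→(29)) `crtIndicator`, `abs_expect_box_indicator_sub_tupleDensity_le`:
  `|E_{x ∈ B}[1_{d_j,d'_j ∣ θ_j(x) ∀ j}] - E_{x ∈ ℤ_D^t}[⋯]| ≤ ∑_j D/ℓ_j` for boxes of sides `ℓ_j ≥ D`;
* (S3-tail, p. 17, (30)) `norm_integral_sub_setIntegral_phiF_le`: truncating the Fourier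
  integral to `|η| ≤ T` costs `O_A(d^{-1/log R} T^{-A})`;
* tools: `norm_prod_add_sub_prod_le` (`|∏(a+b) - ∏ a| ≤ ∏(X+Y) - ∏ X`), `tuplePeriod_dvd_prod`,
  `tuplePeriod_le_prod` (`D ≤ ∏ d_j d'_j ≤ R^{2m}`);
* (expansion, (28)) `divSum`, `slotIdx`, `prod_sq_divSum_eq`, `expect_prod_sq_divSum_eq`:
  `E_{x∈B} ∏_i (K ∑_{d ≤ R, d∣θ_i} c(d))² = K^{2m} ∑_{dd} (∏_v c(dd_v)) E_{x∈B} 1[dd ∣ θ(x)]`;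
* ((28)→(29) summed) `abs_sum_coef_mul_expect_sub_tupleDensity_le`: total error
  `≤ R^{2m} ∑_j R^{2m}/ℓ_j` for `|c| ≤ 1` vanishing off square-free numbers;
* (Euler product with general local coefficients, for the "Estimate (32)" paragraph) `tupleSumG`, `tupleSumG_eq_prod`,
  `tupleSum_eq_tupleSumG`, and the absolute local factor: `sum_localDensity_rpow_eq_one_of_dvd`
  (`= 1` for `p ∣ W`), `sum_localDensity_rpow_le` (`≤ 1 + 3m p^{-1-s} + 4^m p^{-2}` otherwise).

## References
* D. Conlon, J. Fox, Y. Zhao, EMS Surv. Math. Sci. 1 (2014), 249–282, §9. [cite: ConlonFoxZhao2014]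
-/

noncomputable section

open Finset MeasureTheory
open scoped BigOperators

namespace Literature.NumberTheory.Sieve.CFZ

variable {m t : ℕ}

/-- The divisibility indicator read through the Chinese remainder map on `ℤ_D^t`
(`D = tuplePeriod d d'`): `y ↦ ∏_{p ∣ D} 1[∀ j ∈ X_p ∪ X'_p, θ_j(y mod p) = 0]`.
[cite: ConlonFoxZhao2014, Section 9] -/
def crtIndicator (W : ℕ) (L : Fin m → Fin t → ℤ) (b : Fin m → ℤ) (d d' : Fin m → ℕ)
    (y : Fin t → ZMod (tuplePeriod d d')) : ℝ :=
  ∏ p : (tuplePeriod d d').primeFactors,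
    (if ∀ j ∈ pattern d p ∪ pattern d' p,
        wForm W (L j) (b j) (fun i => crtSquarefree (squarefree_tuplePeriod d d') (y i) p) = 0
      then (1 : ℝ) else 0)

/-- `0 ≤ crtIndicator ≤ 1`. [cite: ConlonFoxZhao2014, Section 9] -/
theorem crtIndicator_nonneg_le_one (W : ℕ) (L : Fin m → Fin t → ℤ) (b : Fin m → ℤ) (d d' : Fin m → ℕ)
    (y : Fin t → ZMod (tuplePeriod d d')) :
    0 ≤ crtIndicator W L b d d' y ∧ crtIndicator W L b d d' y ≤ 1 := by
  unfold crtIndicator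
  refine ⟨prod_nonneg fun p _ => by split_ifs <;> norm_num,
    prod_le_one (fun p _ => by split_ifs <;> norm_num) fun p _ => by split_ifs <;> norm_num⟩

/-- The integer indicator is `crtIndicator (x mod D)` (restating `indicator_eq_prod_crt`).
[cite: ConlonFoxZhao2014, Section 9] -/
theorem indicator_eq_crtIndicator (W : ℕ) (L : Fin m → Fin t → ℤ) (b : Fin m → ℤ) {d d' : Fin m → ℕ}
    (hd : ∀ j, Squarefree (d j)) (hd' : ∀ j, Squarefree (d' j)) (x : Fin t → ℤ) :
    (if ∀ j, ((d j : ℤ) ∣ wForm W (L j) (b j) x) ∧ ((d' j : ℤ) ∣ wForm W (L j) (b j) x) then (1 : ℝ)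
      else 0) = crtIndicator W L b d d' (fun i => ((x i : ℤ) : ZMod (tuplePeriod d d'))) :=
  indicator_eq_prod_crt W L b hd hd' x

/-- `tupleDensity = E_{y ∈ ℤ_D^t} crtIndicator(y)`. [cite: ConlonFoxZhao2014, Section 9] -/
theorem tupleDensity_eq_expect_crtIndicator (W : ℕ) (L : Fin m → Fin t → ℤ) (b : Fin m → ℤ)
    {d d' : Fin m → ℕ} (hd : ∀ j, Squarefree (d j)) (hd' : ∀ j, Squarefree (d' j)) :
    haveI : NeZero (tuplePeriod d d') := ⟨tuplePeriod_ne_zero d d'⟩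
    tupleDensity W L b d d' = 𝔼 y : Fin t → ZMod (tuplePeriod d d'), crtIndicator W L b d d' y := by
  haveI : NeZero (tuplePeriod d d') := ⟨tuplePeriod_ne_zero d d'⟩
  unfold tupleDensity
  have hbox : (Fintype.piFinset fun _ : Fin t => Ico (0 : ℤ) (tuplePeriod d d')) =
      Fintype.piFinset fun j : Fin t => Ico ((fun _ => (0 : ℤ)) j)
        ((fun _ => (0 : ℤ)) j + (tuplePeriod d d' : ℕ) * (fun _ => 1) j) := by
    simp
  rw [hbox, ← expect_box_comp_intCast_eq (fun _ => (0 : ℤ)) (fun _ => 1) (fun _ => le_rfl)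
    (crtIndicator W L b d d')]
  exact expect_congr rfl fun x _ => indicator_eq_crtIndicator W L b hd hd' x

/-- **(28) → (29)**: for a box `B = ∏_j [a_j, a_j + ℓ_j)` with `ℓ_j ≥ D`,
`|E_{x ∈ B}[1_{d_j, d'_j ∣ θ_j(x) ∀ j}] - E_{x ∈ ℤ_D^t}[1_{d_j, d'_j ∣ θ_j(x) ∀ j}]| ≤ ∑_j D/ℓ_j`
("by considering a slightly smaller box `B' ⊆ B` such that each dimension of `B'` is divisible by
`D`"). [cite: ConlonFoxZhao2014, Section 9] -/
theorem abs_expect_box_indicator_sub_tupleDensity_le (W : ℕ) (L : Fin m → Fin t → ℤ) (b : Fin m → ℤ)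
    {d d' : Fin m → ℕ} (hd : ∀ j, Squarefree (d j)) (hd' : ∀ j, Squarefree (d' j))
    (a : Fin t → ℤ) (ℓ : Fin t → ℕ) (hℓ : ∀ j, tuplePeriod d d' ≤ ℓ j) :
    |(𝔼 x ∈ Fintype.piFinset (fun j => Ico (a j) (a j + ℓ j)),
        if ∀ j, ((d j : ℤ) ∣ wForm W (L j) (b j) x) ∧ ((d' j : ℤ) ∣ wForm W (L j) (b j) x) then (1 : ℝ)
        else 0) - tupleDensity W L b d d'| ≤ ∑ j, (tuplePeriod d d' : ℝ) / ℓ j := by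
  haveI : NeZero (tuplePeriod d d') := ⟨tuplePeriod_ne_zero d d'⟩
  rw [tupleDensity_eq_expect_crtIndicator W L b hd hd',
    expect_congr rfl fun x _ => indicator_eq_crtIndicator W L b hd hd' x]
  exact abs_expect_box_sub_expect_le a ℓ hℓ (crtIndicator W L b d d')
    (fun y => (crtIndicator_nonneg_le_one W L b d d' y).1)
    (fun y => (crtIndicator_nonneg_le_one W L b d d' y).2)

/-! ### S3-tail: truncating the Fourier integral (CFZ (30)) -/

section Truncation

variable {χ : ℝ → ℝ} (hs : ContDiff ℝ (⊤ : ℕ∞) χ) (hsupp : ∀ x, 1 ≤ |x| → χ x = 0)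
include hs hsupp

/-- The integrand `φ(η) d^{-z(η)}` is integrable (`φ` integrable, `|d^{-z(η)}| = d^{-1/log R}`).
[cite: ConlonFoxZhao2014, Section 9] -/
theorem integrable_phiF_mul_cpow (R : ℝ) {d : ℕ} (hd : 1 ≤ d) :
    Integrable fun η : ℝ => phiF χ η * (d : ℂ) ^ (-(zOf R η)) := by
  have hφ := phiF_integrable hs hsupp
  have hcont : Continuous fun η : ℝ => (d : ℂ) ^ (-(zOf R η)) := by
    refine Continuous.const_cpow ?_ (Or.inl (by exact_mod_cast (by omega : d ≠ 0)))
    unfold zOf; fun_prop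
  have h := hφ.bdd_mul (c := (d : ℝ) ^ (-(1 / Real.log R))) hcont.aestronglyMeasurable
    (Filter.Eventually.of_forall fun η => (norm_natCast_cpow_neg_zOf R hd η).le)
  simpa [mul_comm] using h

/-- **Truncation (CFZ (30))**: for every `A` there is `C` such that for all `T ≥ 1`, `R`, `d ≥ 1`,
`‖∫_ℝ φ(η) d^{-z(η)} dη - ∫_{[-T,T]} φ(η) d^{-z(η)} dη‖ ≤ C d^{-1/log R} T^{-A}`
(rapid decay of `φ`; CFZ take `T = log^{1/2} R`). [cite: ConlonFoxZhao2014, Section 9] -/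
theorem norm_integral_sub_setIntegral_phiF_le (A : ℕ) : ∃ C : ℝ, 0 ≤ C ∧ ∀ T : ℝ, 1 ≤ T →
    ∀ R : ℝ, ∀ d : ℕ, 1 ≤ d →
      ‖(∫ η : ℝ, phiF χ η * (d : ℂ) ^ (-(zOf R η))) -
          ∫ η in Set.Icc (-T) T, phiF χ η * (d : ℂ) ^ (-(zOf R η))‖ ≤
        C * (d : ℝ) ^ (-(1 / Real.log R)) * (T ^ A)⁻¹ := by
  obtain ⟨C₀, hC₀, hφ⟩ := norm_phiF_le hs hsupp (A + 2)
  -- `∫ (1+|η|)^{-2} dη < ∞`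
  have hint : Integrable fun η : ℝ => (1 + ‖η‖) ^ (-(2 : ℝ)) :=
    integrable_one_add_norm (by simp)
  set M := ∫ η : ℝ, (1 + ‖η‖) ^ (-(2 : ℝ)) with hM
  have hM0 : 0 ≤ M := integral_nonneg fun η => by positivity
  refine ⟨C₀ * M, by positivity, fun T hT R d hd => ?_⟩
  set f : ℝ → ℂ := fun η => phiF χ η * (d : ℂ) ^ (-(zOf R η)) with hf
  have hfi : Integrable f := integrable_phiF_mul_cpow hs hsupp R hd
  rw [← integral_add_compl (measurableSet_Icc (a := -T) (b := T)) hfi, add_sub_cancel_left]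
  -- pointwise bound on the complement
  set K : ℝ := C₀ * (d : ℝ) ^ (-(1 / Real.log R)) * (T ^ A)⁻¹ with hK
  have hK0 : 0 ≤ K := by positivity
  have hT0 : 0 < T := by linarith
  have hbound : ∀ η ∈ (Set.Icc (-T) T)ᶜ, ‖f η‖ ≤ K * (1 + ‖η‖) ^ (-(2 : ℝ)) := by
    intro η hη
    have hηT : T ≤ |η| := by
      simp only [Set.mem_compl_iff, Set.mem_Icc, not_and_or, not_le] at hη
      rcases hη with h | h
      · rw [abs_of_neg (by linarith)]; linarith
      · exact h.le.trans (le_abs_self η)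
    rw [hf, norm_mul, norm_natCast_cpow_neg_zOf R hd η]
    have h1 := hφ η
    have hpos : 0 < 1 + |η| := by positivity
    -- `(1+|η|)^{-(A+2)} ≤ T^{-A} (1+|η|)^{-2}`
    have hsplit : ((1 + |η|) ^ (A + 2))⁻¹ ≤ (T ^ A)⁻¹ * (1 + ‖η‖) ^ (-(2 : ℝ)) := by
      rw [Real.norm_eq_abs, Real.rpow_neg hpos.le, ← mul_inv, pow_add]
      rw [show ((1 + |η|) ^ (2 : ℝ)) = (1 + |η|) ^ (2 : ℕ) by norm_cast]
      have hTA : T ^ A ≤ (1 + |η|) ^ A :=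
        calc T ^ A ≤ |η| ^ A := pow_le_pow_left₀ hT0.le hηT A
          _ ≤ (1 + |η|) ^ A := pow_le_pow_left₀ (abs_nonneg η) (by linarith [abs_nonneg η]) A
      exact inv_anti₀ (by positivity) (mul_le_mul_of_nonneg_right hTA (by positivity))
    calc ‖phiF χ η‖ * (d : ℝ) ^ (-(1 / Real.log R))
        ≤ C₀ * ((1 + |η|) ^ (A + 2))⁻¹ * (d : ℝ) ^ (-(1 / Real.log R)) := by gcongr
      _ ≤ C₀ * ((T ^ A)⁻¹ * (1 + ‖η‖) ^ (-(2 : ℝ))) * (d : ℝ) ^ (-(1 / Real.log R)) := by gcongr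
      _ = K * (1 + ‖η‖) ^ (-(2 : ℝ)) := by rw [hK]; ring
  calc ‖∫ η in (Set.Icc (-T) T)ᶜ, f η‖ ≤ ∫ η in (Set.Icc (-T) T)ᶜ, K * (1 + ‖η‖) ^ (-(2 : ℝ)) := by
        refine norm_integral_le_of_norm_le (hint.const_mul K).integrableOn ?_
        exact (ae_restrict_iff' (measurableSet_Icc.compl)).2 (Filter.Eventually.of_forall hbound)
    _ ≤ ∫ η : ℝ, K * (1 + ‖η‖) ^ (-(2 : ℝ)) :=
        setIntegral_le_integral (hint.const_mul K) (Filter.Eventually.of_forall fun η => by positivity)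
    _ = K * M := by rw [integral_const_mul, hM]
    _ = C₀ * M * (d : ℝ) ^ (-(1 / Real.log R)) * (T ^ A)⁻¹ := by rw [hK]; ring

end Truncation

/-! ### Small generic tools for the assembly -/

/-- `|∏_v (a_v + b_v) - ∏_v a_v| ≤ ∏_v (X_v + Y_v) - ∏_v X_v` whenever `|a_v| ≤ X_v`, `|b_v| ≤ Y_v`
(expand and bound term by term). [folklore] -/
theorem norm_prod_add_sub_prod_le {ι : Type*} [DecidableEq ι] (s : Finset ι) (a b : ι → ℂ)
    {X Y : ι → ℝ} (hX : ∀ v ∈ s, ‖a v‖ ≤ X v) (hY : ∀ v ∈ s, ‖b v‖ ≤ Y v) :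
    ‖∏ v ∈ s, (a v + b v) - ∏ v ∈ s, a v‖ ≤ ∏ v ∈ s, (X v + Y v) - ∏ v ∈ s, X v := by
  induction s using Finset.induction_on with
  | empty => simp
  | insert i s hi ih =>
    have hX' := fun v hv => hX v (mem_insert_of_mem hv)
    have hY' := fun v hv => hY v (mem_insert_of_mem hv)
    have ih' := ih hX' hY'
    have hXi := hX i (mem_insert_self i s)
    have hYi := hY i (mem_insert_self i s)
    have hX0 : ∀ v ∈ s, 0 ≤ X v := fun v hv => (norm_nonneg _).trans (hX' v hv)
    rw [prod_insert hi, prod_insert hi, prod_insert hi, prod_insert hi]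
    have hid : (a i + b i) * ∏ v ∈ s, (a v + b v) - a i * ∏ v ∈ s, a v =
        (a i + b i) * (∏ v ∈ s, (a v + b v) - ∏ v ∈ s, a v) + b i * ∏ v ∈ s, a v := by ring
    rw [hid]
    have hP : ‖∏ v ∈ s, a v‖ ≤ ∏ v ∈ s, X v := by
      rw [norm_prod]; exact prod_le_prod (fun v _ => norm_nonneg _) hX'
    have hPle : ∏ v ∈ s, X v ≤ ∏ v ∈ s, (X v + Y v) :=
      prod_le_prod hX0 fun v hv => le_add_of_nonneg_right ((norm_nonneg _).trans (hY' v hv))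
    have h0 : 0 ≤ ∏ v ∈ s, (X v + Y v) - ∏ v ∈ s, X v := by linarith
    calc ‖(a i + b i) * (∏ v ∈ s, (a v + b v) - ∏ v ∈ s, a v) + b i * ∏ v ∈ s, a v‖
        ≤ ‖a i + b i‖ * ‖∏ v ∈ s, (a v + b v) - ∏ v ∈ s, a v‖ + ‖b i‖ * ‖∏ v ∈ s, a v‖ := by
          refine (norm_add_le _ _).trans ?_; rw [norm_mul, norm_mul]
      _ ≤ (X i + Y i) * (∏ v ∈ s, (X v + Y v) - ∏ v ∈ s, X v) + Y i * ∏ v ∈ s, X v :=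
          add_le_add (mul_le_mul ((norm_add_le _ _).trans (add_le_add hXi hYi)) ih' (norm_nonneg _)
            (by linarith [norm_nonneg (a i), norm_nonneg (b i)]))
            (mul_le_mul hYi hP (norm_nonneg _) ((norm_nonneg _).trans hYi))
      _ = (X i + Y i) * ∏ v ∈ s, (X v + Y v) - X i * ∏ v ∈ s, X v := by ring

/-- The period divides the product of the entries (square-free entries):
`tuplePeriod d d' ∣ ∏_j d_j d'_j`. [cite: ConlonFoxZhao2014, Section 9] -/
theorem tuplePeriod_dvd_prod {d d' : Fin m → ℕ} :
    tuplePeriod d d' ∣ ∏ j, d j * d' j := by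
  unfold tuplePeriod
  refine Finset.prod_primes_dvd _ (fun p hp => Nat.prime_iff.1 (prime_of_mem_tuplePrimes hp)) fun p hp => ?_
  simp only [tuplePrimes, mem_biUnion, mem_univ, true_and, mem_union] at hp
  obtain ⟨j, h | h⟩ := hp
  · exact (Nat.dvd_of_mem_primeFactors h).trans
      ((dvd_mul_right _ _).trans (Finset.dvd_prod_of_mem (fun j => d j * d' j) (mem_univ j)))
  · exact (Nat.dvd_of_mem_primeFactors h).trans
      ((dvd_mul_left _ _).trans (Finset.dvd_prod_of_mem (fun j => d j * d' j) (mem_univ j)))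

/-- "`D ≤ R^{2m}`": `tuplePeriod d d' ≤ ∏_j d_j d'_j` when all entries are positive.
[cite: ConlonFoxZhao2014, Section 9] -/
theorem tuplePeriod_le_prod {d d' : Fin m → ℕ} (hd : ∀ j, 0 < d j) (hd' : ∀ j, 0 < d' j) :
    tuplePeriod d d' ≤ ∏ j, d j * d' j :=
  Nat.le_of_dvd (prod_pos fun j _ => Nat.mul_pos (hd j) (hd' j)) tuplePeriod_dvd_prod

/-! ### S7 step (i)–(ii): expanding `∏_i Λ(θ_i)²` into the sum over pairs of tuples (CFZ (28)) -/

/-- A truncated divisor sum with coefficients: `∑_{d ≤ R, d ∣ n} c(d)`. This is the tree's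
`Literature.moebiusDivisorSum χ R n` (`Literature/NumberTheory/Sieve/LinearEquationsInPrimesSieveWeights.lean`)
at one more parameter of generality: `Literature.moebiusDivisorSum χ R = divSum (Literature.moebiusWeight χ R) R`
holds by `rfl`, and CFZ's `Λ_{χ,R}` (Def. 8.2) is the tree's `Literature.truncDivisorSum χ R 1 = log R · (…)`
(= `Literature.NumberTheory.Sieve.GreenTao2008.smoothDivisorSum`). The generality is only notational (the expansion below is
stated for any coefficients); the `rfl` link lemma `moebiusDivisorSum_eq_divSum` is carried by the
file that states the discharge of `SmoothLinearFormsEstimate` (planned `SmoothMajorantFinal.lean`,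
which imports both `GreenTao2008SmoothMajorant` and this file) — importing the sieve-weights file
here would drag `LinearEquationsInPrimesProofs` into this elementary layer.
[cite: ConlonFoxZhao2014, Definition 8.2] -/
def divSum (c : ℕ → ℝ) (R : ℝ) (n : ℤ) : ℝ :=
  ∑ d ∈ (Icc 1 ⌊R⌋₊).filter (fun d : ℕ => (d : ℤ) ∣ n), c d

/-- The index of `θ` attached to a slot of `[m] ⊔ [m]`. [cite: ConlonFoxZhao2014, Section 9] -/
def slotIdx : Fin m ⊕ Fin m → Fin m := Sum.elim id id

/-- **Expansion (CFZ (28))**: for integer points `x`,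
`∏_i (K · ∑_{d ≤ R, d ∣ θ_i(x)} c(d))² = K^{2m} ∑_{dd} (∏_v c(dd_v)) 1[∀ j, dd_{inl j}, dd_{inr j} ∣ θ_j(x)]`,
the sum over `dd : [m] ⊔ [m] → [1, R]`. [cite: ConlonFoxZhao2014, Section 9, equation (28)] -/
theorem prod_sq_divSum_eq (c : ℕ → ℝ) (R K : ℝ) (W : ℕ) (L : Fin m → Fin t → ℤ) (b : Fin m → ℤ)
    (x : Fin t → ℤ) :
    ∏ i, (K * divSum c R (wForm W (L i) (b i) x)) ^ 2 =
      K ^ (2 * m) * ∑ dd ∈ Fintype.piFinset (fun _ : Fin m ⊕ Fin m => Icc 1 ⌊R⌋₊),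
        (∏ v, c (dd v)) *
          (if ∀ j, ((dd (Sum.inl j) : ℤ) ∣ wForm W (L j) (b j) x) ∧ ((dd (Sum.inr j) : ℤ) ∣ wForm W (L j) (b j) x)
            then (1 : ℝ) else 0) := by
  classical
  -- `∏_i S_i² = ∏_{v : [m] ⊔ [m]} S_{slot v}`
  have hsq : ∏ i, (K * divSum c R (wForm W (L i) (b i) x)) ^ 2 =
      ∏ v : Fin m ⊕ Fin m, (K * divSum c R (wForm W (L (slotIdx v)) (b (slotIdx v)) x)) := by
    rw [Fintype.prod_sum_type]
    simp only [slotIdx, Sum.elim_inl, Sum.elim_inr, id, ← prod_mul_distrib, sq]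
  rw [hsq, prod_mul_distrib, prod_const, card_univ, Fintype.card_sum, Fintype.card_fin, ← two_mul]
  congr 1
  -- expand the product of sums
  have hS : ∀ v : Fin m ⊕ Fin m, divSum c R (wForm W (L (slotIdx v)) (b (slotIdx v)) x) =
      ∑ d ∈ Icc 1 ⌊R⌋₊, c d * (if ((d : ℤ) ∣ wForm W (L (slotIdx v)) (b (slotIdx v)) x) then (1 : ℝ) else 0) := by
    intro v
    unfold divSum
    rw [sum_filter]
    exact sum_congr rfl fun d _ => by rw [mul_boole]
  simp_rw [hS]
  rw [prod_univ_sum]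
  refine sum_congr rfl fun dd _ => ?_
  rw [prod_mul_distrib, prod_boole]
  have hiff : (∀ v ∈ (univ : Finset (Fin m ⊕ Fin m)),
      (dd v : ℤ) ∣ wForm W (L (slotIdx v)) (b (slotIdx v)) x) ↔
      ∀ j, ((dd (Sum.inl j) : ℤ) ∣ wForm W (L j) (b j) x) ∧ ((dd (Sum.inr j) : ℤ) ∣ wForm W (L j) (b j) x) := by
    simp only [mem_univ, true_imp_iff, Sum.forall, slotIdx, Sum.elim_inl, Sum.elim_inr, id]
    exact ⟨fun h j => ⟨h.1 j, h.2 j⟩, fun h => ⟨fun j => (h j).1, fun j => (h j).2⟩⟩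
  by_cases h : ∀ j, ((dd (Sum.inl j) : ℤ) ∣ wForm W (L j) (b j) x) ∧ ((dd (Sum.inr j) : ℤ) ∣ wForm W (L j) (b j) x)
  · rw [if_pos h, if_pos (hiff.2 h)]
  · rw [if_neg h, if_neg (fun h' => h (hiff.1 h'))]

/-- **Averaging the expansion over the box** (CFZ (28)):
`E_{x∈B} ∏_i (K ∑_{d∣θ_i} c)² = K^{2m} ∑_{dd} (∏ c(dd_v)) E_{x∈B} 1[dd ∣ θ(x)]`.
[cite: ConlonFoxZhao2014, Section 9, equation (28)] -/
theorem expect_prod_sq_divSum_eq (c : ℕ → ℝ) (R K : ℝ) (W : ℕ) (L : Fin m → Fin t → ℤ) (b : Fin m → ℤ)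
    (B : Finset (Fin t → ℤ)) :
    𝔼 x ∈ B, ∏ i, (K * divSum c R (wForm W (L i) (b i) x)) ^ 2 =
      K ^ (2 * m) * ∑ dd ∈ Fintype.piFinset (fun _ : Fin m ⊕ Fin m => Icc 1 ⌊R⌋₊),
        (∏ v, c (dd v)) * 𝔼 x ∈ B,
          (if ∀ j, ((dd (Sum.inl j) : ℤ) ∣ wForm W (L j) (b j) x) ∧ ((dd (Sum.inr j) : ℤ) ∣ wForm W (L j) (b j) x)
            then (1 : ℝ) else 0) := by
  simp_rw [prod_sq_divSum_eq c R K W L b]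
  rw [← mul_expect, expect_sum_comm]
  congr 1
  exact sum_congr rfl fun dd _ => (mul_expect _ _ _).symm

/-! ### S7 step (iii): from box averages to the weights `tupleDensity` (CFZ (28) → (29)) -/

/-- **(28) → (29) summed over the tuples**: with coefficients `|c| ≤ 1` vanishing off the
square-free numbers and a box of sides `ℓ_j ≥ R^{2m}`,
`|∑_{dd ≤ R} (∏ c(dd_v)) (E_{x∈B} 1[dd ∣ θ(x)] - tupleDensity(dd))| ≤ R^{2m} ∑_j R^{2m}/ℓ_j`
(each `D ≤ ∏ dd_v ≤ R^{2m}`; at most `R^{2m}` tuples). [cite: ConlonFoxZhao2014, Section 9] -/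
theorem abs_sum_coef_mul_expect_sub_tupleDensity_le (c : ℕ → ℝ) (hc1 : ∀ d, |c d| ≤ 1)
    (hcμ : ∀ d, ¬Squarefree d → c d = 0) {R : ℝ} (hR : 1 ≤ R) (W : ℕ) (L : Fin m → Fin t → ℤ)
    (b : Fin m → ℤ) (a : Fin t → ℤ) (ℓ : Fin t → ℕ) (hℓ : ∀ j, R ^ (2 * m) ≤ ℓ j) :
    |∑ dd ∈ Fintype.piFinset (fun _ : Fin m ⊕ Fin m => Icc 1 ⌊R⌋₊),
        (∏ v, c (dd v)) *
          ((𝔼 x ∈ Fintype.piFinset (fun j => Ico (a j) (a j + ℓ j)),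
              (if ∀ j, ((dd (Sum.inl j) : ℤ) ∣ wForm W (L j) (b j) x) ∧
                  ((dd (Sum.inr j) : ℤ) ∣ wForm W (L j) (b j) x) then (1 : ℝ) else 0)) -
            tupleDensity W L b (fun j => dd (Sum.inl j)) (fun j => dd (Sum.inr j)))| ≤
      R ^ (2 * m) * ∑ j, R ^ (2 * m) / ℓ j := by
  classical
  have hR0 : (0 : ℝ) ≤ R := by linarith
  set T := Fintype.piFinset (fun _ : Fin m ⊕ Fin m => Icc 1 ⌊R⌋₊) with hT
  -- per-tuple bound
  have hper : ∀ dd ∈ T, |(∏ v, c (dd v)) *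
      ((𝔼 x ∈ Fintype.piFinset (fun j => Ico (a j) (a j + ℓ j)),
          (if ∀ j, ((dd (Sum.inl j) : ℤ) ∣ wForm W (L j) (b j) x) ∧
              ((dd (Sum.inr j) : ℤ) ∣ wForm W (L j) (b j) x) then (1 : ℝ) else 0)) -
        tupleDensity W L b (fun j => dd (Sum.inl j)) (fun j => dd (Sum.inr j)))| ≤
      ∑ j, R ^ (2 * m) / ℓ j := by
    intro dd hdd
    rw [hT, Fintype.mem_piFinset] at hdd
    have hdd1 : ∀ v, 1 ≤ dd v ∧ dd v ≤ ⌊R⌋₊ := fun v => by simpa using hdd v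
    by_cases hsq : ∀ v, Squarefree (dd v)
    · -- square-free tuple: S2-link
      have hcoef : |∏ v, c (dd v)| ≤ 1 := by
        rw [abs_prod]; exact prod_le_one (fun v _ => abs_nonneg _) fun v _ => hc1 _
      have hDle : (tuplePeriod (fun j => dd (Sum.inl j)) (fun j => dd (Sum.inr j)) : ℝ) ≤ R ^ (2 * m) := by
        have h1 := tuplePeriod_le_prod (d := fun j => dd (Sum.inl j)) (d' := fun j => dd (Sum.inr j))
          (fun j => (hdd1 _).1) (fun j => (hdd1 _).1)
        have h2 : (∏ j, dd (Sum.inl j) * dd (Sum.inr j) : ℕ) ≤ ⌊R⌋₊ ^ (2 * m) := by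
          calc (∏ j, dd (Sum.inl j) * dd (Sum.inr j) : ℕ) ≤ ∏ _j : Fin m, ⌊R⌋₊ * ⌊R⌋₊ :=
                prod_le_prod' fun j _ => Nat.mul_le_mul (hdd1 _).2 (hdd1 _).2
            _ = ⌊R⌋₊ ^ (2 * m) := by rw [prod_const, card_univ, Fintype.card_fin, ← sq, ← pow_mul, mul_comm]
        calc (tuplePeriod (fun j => dd (Sum.inl j)) (fun j => dd (Sum.inr j)) : ℝ)
            ≤ ((⌊R⌋₊ ^ (2 * m) : ℕ) : ℝ) := by exact_mod_cast h1.trans h2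
          _ ≤ R ^ (2 * m) := by push_cast; exact pow_le_pow_left₀ (by positivity) (Nat.floor_le hR0) _
      have hℓD : ∀ j, tuplePeriod (fun j => dd (Sum.inl j)) (fun j => dd (Sum.inr j)) ≤ ℓ j := fun j => by
        exact_mod_cast hDle.trans (hℓ j)
      have hlink := abs_expect_box_indicator_sub_tupleDensity_le W L b
        (d := fun j => dd (Sum.inl j)) (d' := fun j => dd (Sum.inr j))
        (fun j => hsq _) (fun j => hsq _) a ℓ hℓD
      rw [abs_mul]
      calc |∏ v, c (dd v)| * _ ≤ 1 * ∑ j, (tuplePeriod (fun j => dd (Sum.inl j)) (fun j => dd (Sum.inr j)) : ℝ) / ℓ j :=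
            mul_le_mul hcoef hlink (abs_nonneg _) zero_le_one
        _ ≤ 1 * ∑ j, R ^ (2 * m) / ℓ j := by gcongr with j
        _ = ∑ j, R ^ (2 * m) / ℓ j := one_mul _
    · -- a non-square-free entry kills the coefficient
      push Not at hsq
      obtain ⟨v, hv⟩ := hsq
      have h0 : ∏ v, c (dd v) = 0 := prod_eq_zero (mem_univ v) (hcμ _ hv)
      rw [h0, zero_mul, abs_zero]
      exact sum_nonneg fun j _ => by positivity
  -- sum over the tuples
  calc |∑ dd ∈ T, _| ≤ ∑ dd ∈ T, |(∏ v, c (dd v)) *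
        ((𝔼 x ∈ Fintype.piFinset (fun j => Ico (a j) (a j + ℓ j)),
            (if ∀ j, ((dd (Sum.inl j) : ℤ) ∣ wForm W (L j) (b j) x) ∧
                ((dd (Sum.inr j) : ℤ) ∣ wForm W (L j) (b j) x) then (1 : ℝ) else 0)) -
          tupleDensity W L b (fun j => dd (Sum.inl j)) (fun j => dd (Sum.inr j)))| :=
        abs_sum_le_sum_abs _ _
    _ ≤ ∑ _dd ∈ T, ∑ j, R ^ (2 * m) / ℓ j := sum_le_sum hper
    _ = #T * ∑ j, R ^ (2 * m) / ℓ j := by rw [sum_const, nsmul_eq_mul]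
    _ ≤ R ^ (2 * m) * ∑ j, R ^ (2 * m) / ℓ j := by
        have hS0 : 0 ≤ ∑ j, R ^ (2 * m) / ℓ j := sum_nonneg fun j _ => by positivity
        have hcard : (#T : ℝ) ≤ R ^ (2 * m) := by
          rw [hT, Fintype.card_piFinset, prod_const, Nat.card_Icc, card_univ, Fintype.card_sum,
            Fintype.card_fin, ← two_mul]
          push_cast
          have : ((⌊R⌋₊ + 1 - 1 : ℕ) : ℝ) ≤ R := by
            rw [Nat.add_sub_cancel]; exact Nat.floor_le hR0
          exact pow_le_pow_left₀ (by positivity) this _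
        exact mul_le_mul_of_nonneg_right hcard hS0

/-! ### S7 tool: the Euler product over tuples with general local coefficients -/

/-- The sum over pairs of square-free tuples with prime factors in `P` of
`tupleDensity(dd) ∏_v ∏_{p ∣ dd_v} g(p, v)` — `tupleSum` is the case `g(p,v) = -p^{-w_v}`; the
absolute version `g(p, v) = p^{-s}` controls the error terms (CFZ, "Error estimates: Estimate (32)").
[cite: ConlonFoxZhao2014, Section 9] -/
def tupleSumG (P : Finset ℕ) (W : ℕ) (L : Fin m → Fin t → ℤ) (b : Fin m → ℤ)
    (g : ℕ → Fin m ⊕ Fin m → ℂ) : ℂ :=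
  ∑ dd ∈ Fintype.piFinset (fun _ : Fin m ⊕ Fin m => squarefreeOf P),
    (tupleDensity W L b (fun j => dd (Sum.inl j)) (fun j => dd (Sum.inr j)) : ℂ) *
      ∏ v, ∏ p ∈ (dd v).primeFactors, g p v

/-- **`tupleSumG = ∏_{p ∈ P} ∑_Y ω_p(π Y) ∏_{v ∈ Y} g(p, v)`** (same proof as
`tupleSum_eq_prod_eulerFactor`). [cite: ConlonFoxZhao2014, Section 9] -/
theorem tupleSumG_eq_prod {P : Finset ℕ} (hP : ∀ p ∈ P, p.Prime) (W : ℕ) (L : Fin m → Fin t → ℤ)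
    (b : Fin m → ℤ) (g : ℕ → Fin m ⊕ Fin m → ℂ) :
    tupleSumG P W L b g = ∏ p ∈ P, ∑ Y : Finset (Fin m ⊕ Fin m),
      (localDensity₀ p W L b (projPattern Y) : ℂ) * ∏ v ∈ Y, g p v := by
  classical
  set f : P → Finset (Fin m ⊕ Fin m) → ℂ := fun p Y =>
    (localDensity₀ p W L b (projPattern Y) : ℂ) * ∏ v ∈ Y, g p v with hf
  have hrhs : (∏ p ∈ P, ∑ Y : Finset (Fin m ⊕ Fin m),
      (localDensity₀ p W L b (projPattern Y) : ℂ) * ∏ v ∈ Y, g p v) = ∏ p : P, ∑ Y, f p Y := by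
    rw [← prod_coe_sort P]
  rw [hrhs, ← sum_squarefreeTuples_eq_prod hP f]
  refine sum_congr rfl fun dd hdd => ?_
  rw [Fintype.mem_piFinset] at hdd
  have hsq : ∀ v, Squarefree (dd v) ∧ (dd v).primeFactors ⊆ P := fun v => (mem_squarefreeOf hP).1 (hdd v)
  rw [tupleDensity_eq_prod_localDensity W L b hP (fun j => hdd _) (fun j => hdd _)]
  have hcoef : ∏ v, ∏ p ∈ (dd v).primeFactors, g p v = ∏ p ∈ P, ∏ v ∈ pattern dd p, g p v := by
    rw [Finset.prod_comm' (s := univ) (t := fun v => (dd v).primeFactors) (t' := P)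
      (s' := fun p => pattern dd p)]
    intro v p
    simp only [mem_univ, true_and, pattern, mem_filter]
    constructor
    · intro hp
      exact ⟨Nat.dvd_of_mem_primeFactors hp, (hsq v).2 hp⟩
    · rintro ⟨hpd, hpP⟩
      exact Nat.mem_primeFactors.2 ⟨hP p hpP, hpd, (hsq v).1.ne_zero⟩
  rw [hcoef, Complex.ofReal_prod, ← prod_mul_distrib, ← prod_coe_sort P]
  refine Fintype.prod_congr _ _ fun p => ?_
  simp only [hf, projPattern_pattern]

/-- `tupleSum` is the case `g(p, v) = -p^{-w_v}` of `tupleSumG` (`μ(n) n^{-w} = ∏_{p ∣ n} (-p^{-w})` for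
square-free `n`), so `tupleSum_eq_prod_eulerFactor` is also the corresponding case of `tupleSumG_eq_prod`.
[cite: ConlonFoxZhao2014, Section 9] -/
theorem tupleSum_eq_tupleSumG {P : Finset ℕ} (hP : ∀ p ∈ P, p.Prime) (W : ℕ) (L : Fin m → Fin t → ℤ)
    (b : Fin m → ℤ) (z z' : Fin m → ℂ) :
    tupleSum P W L b z z' = tupleSumG P W L b fun p v => -((p : ℂ) ^ (-(sumExp z z' v))) := by
  unfold tupleSum tupleSumG
  refine sum_congr rfl fun dd hdd => ?_
  rw [Fintype.mem_piFinset] at hdd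
  congr 1
  exact Fintype.prod_congr _ _ fun v => moebius_mul_cpow_eq_prod ((mem_squarefreeOf hP).1 (hdd v)).1 _

/-- The absolute local factor `E⁺_p(s) = ∑_Y ω_p(π Y) p^{-s |Y|}` (which bounds `|E_p|`) is `= 1` for
`p ∣ W`: every nonempty pattern has `ω_p = 0`. [cite: ConlonFoxZhao2014, Section 9, Error estimates, Estimate (32)] -/
theorem sum_localDensity_rpow_eq_one_of_dvd {p W : ℕ} [Fact p.Prime] (hpW : p ∣ W)
    (L : Fin m → Fin t → ℤ) (b : Fin m → ℤ) (s : ℝ) :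
    ∑ Y : Finset (Fin m ⊕ Fin m), localDensity₀ p W L b (projPattern Y) * ∏ _v ∈ Y, (p : ℝ) ^ (-s) = 1 := by
  haveI : NeZero p := ⟨(Fact.out : p.Prime).ne_zero⟩
  rw [Fintype.sum_eq_single ∅]
  · simp [localDensity₀_empty]
  · intro Y hY
    rw [localDensity₀_eq,
      localDensity_eq_zero_of_dvd hpW L b (projPattern_nonempty (nonempty_iff_ne_empty.2 hY))]
    simp

/-- The absolute local factor `E⁺_p(s) = ∑_Y ω_p(π Y) p^{-s |Y|}` is
`≤ 1 + 3m p^{-1-s} + 4^m p^{-2}` for `p ∤ W` and a system non-degenerate modulo `p`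
(three patterns over each `{j}`, at most `4^m` patterns in all).
[cite: ConlonFoxZhao2014, Section 9, Error estimates, Estimate (32)] -/
theorem sum_localDensity_rpow_le {p W n : ℕ} [Fact p.Prime] (hpW : ¬ p ∣ W)
    (L : Fin m → Fin (n + 1) → ℤ) (b : Fin m → ℤ)
    (hrow : ∀ i, ∃ j, (L i j : ZMod p) ≠ 0)
    (hmin : ∀ i i', i ≠ i' → ∃ j₀ j₁ : Fin (n + 1), j₀ ≠ j₁ ∧
      ((L i j₀ * L i' j₁ - L i j₁ * L i' j₀ : ℤ) : ZMod p) ≠ 0)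
    {s : ℝ} (hs : 0 ≤ s) :
    ∑ Y : Finset (Fin m ⊕ Fin m), localDensity₀ p W L b (projPattern Y) * ∏ _v ∈ Y, (p : ℝ) ^ (-s) ≤
      1 + 3 * m * (p : ℝ) ^ (-(1 + s)) + 4 ^ m / (p : ℝ) ^ 2 := by
  classical
  have hp : p.Prime := Fact.out
  haveI : NeZero p := ⟨hp.ne_zero⟩
  have hp0 : (0 : ℝ) < p := by exact_mod_cast hp.pos
  have hp1 : (1 : ℝ) ≤ p := by exact_mod_cast hp.one_lt.le
  have hps : (p : ℝ) ^ (-s) ≤ 1 := Real.rpow_le_one_of_one_le_of_nonpos hp1 (by linarith)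
  have hps0 : 0 ≤ (p : ℝ) ^ (-s) := by positivity
  set T : Finset (Fin m ⊕ Fin m) → ℝ := fun Y => localDensity₀ p W L b (projPattern Y) * ∏ _v ∈ Y, (p : ℝ) ^ (-s)
  have hT0 : ∀ Y, 0 ≤ T Y := fun Y =>
    mul_nonneg (localDensity₀_nonneg_le_one p W L b _).1 (prod_nonneg fun _ _ => hps0)
  -- split by `#π(Y)`: `0`, `1`, `≥ 2`
  have hsplit : ∑ Y, T Y = ∑ Y ∈ univ.filter (fun Y => #(projPattern Y) ≤ 1), T Y +
      ∑ Y ∈ univ.filter (fun Y => ¬ #(projPattern Y) ≤ 1), T Y := (sum_filter_add_sum_filter_not _ _ _).symm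
  have hset : (univ : Finset (Finset (Fin m ⊕ Fin m))).filter (fun Y => #(projPattern Y) ≤ 1) =
      insert ∅ ((univ : Finset (Fin m)).biUnion fun j =>
        (univ : Finset (Finset (Fin m ⊕ Fin m))).filter fun Y => projPattern Y = {j}) := by
    ext Y
    simp only [mem_filter, mem_univ, true_and, mem_insert, mem_biUnion]
    constructor
    · intro h
      rcases Nat.lt_or_ge (#(projPattern Y)) 1 with h0 | h1
      · left; exact projPattern_eq_empty_iff.1 (card_eq_zero.1 (by omega))
      · right; obtain ⟨j, hj⟩ := card_eq_one.1 (le_antisymm h h1); exact ⟨j, hj⟩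
    · rintro (rfl | ⟨j, hj⟩)
      · simp
      · rw [hj, card_singleton]
  have hnotin : (∅ : Finset (Fin m ⊕ Fin m)) ∉ (univ : Finset (Fin m)).biUnion fun j =>
      (univ : Finset (Finset (Fin m ⊕ Fin m))).filter fun Y => projPattern Y = {j} := by
    simp only [mem_biUnion, mem_univ, true_and, mem_filter, projPattern_empty, not_exists]
    intro j h
    exact (singleton_ne_empty j) h.symm
  have hdisj : ((univ : Finset (Fin m)) : Set (Fin m)).PairwiseDisjoint fun j =>
      (univ : Finset (Finset (Fin m ⊕ Fin m))).filter fun Y => projPattern Y = {j} := by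
    intro j _ j' _ hjj'
    simp only [Function.onFun, disjoint_left, mem_filter, mem_univ, true_and]
    intro Y hY hY'
    rw [hY] at hY'
    exact hjj' (singleton_injective hY')
  -- the fibre over `{j}`: the three patterns `{inl j}, {inr j}, {inl j, inr j}`
  have hfib : ∀ j : Fin m, ∑ Y ∈ (univ : Finset (Finset (Fin m ⊕ Fin m))).filter (fun Y => projPattern Y = {j}), T Y ≤
      3 * (p : ℝ) ^ (-(1 + s)) := by
    intro j
    have hω : localDensity₀ p W L b {j} = 1 / p := by
      obtain ⟨j₀, hj₀⟩ := hrow j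
      rw [localDensity₀_eq]; exact localDensity_singleton hpW L b j hj₀
    have hTj : ∀ Y ∈ (univ : Finset (Finset (Fin m ⊕ Fin m))).filter (fun Y => projPattern Y = {j}),
        T Y = 1 / p * ∏ _v ∈ Y, (p : ℝ) ^ (-s) := fun Y hY => by
      simp only [T]; rw [(mem_filter.1 hY).2, hω]
    rw [sum_congr rfl hTj, ← mul_sum, filter_projPattern_eq_singleton]
    have hlr : Sum.inl j ≠ (Sum.inr j : Fin m ⊕ Fin m) := Sum.inl_ne_inr
    have h1 : ({Sum.inl j} : Finset (Fin m ⊕ Fin m)) ∉ ({{Sum.inr j}, {Sum.inl j, Sum.inr j}} :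
        Finset (Finset (Fin m ⊕ Fin m))) := by
      simp only [mem_insert, mem_singleton, not_or]
      constructor
      · intro h; have := congrArg (Sum.inl j ∈ ·) h; simp [hlr] at this
      · intro h; have := congrArg (Sum.inr j ∈ ·) h; simp [hlr.symm] at this
    have h2 : ({Sum.inr j} : Finset (Fin m ⊕ Fin m)) ∉ ({{Sum.inl j, Sum.inr j}} :
        Finset (Finset (Fin m ⊕ Fin m))) := by
      simp only [mem_singleton]
      intro h; have := congrArg (Sum.inl j ∈ ·) h; simp [hlr] at this
    rw [sum_insert h1, sum_insert h2, sum_singleton, prod_singleton, prod_singleton, prod_pair hlr]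
    have hpp : (p : ℝ) ^ (-s) * (p : ℝ) ^ (-s) ≤ (p : ℝ) ^ (-s) := mul_le_of_le_one_right hps0 hps
    have hkey : 1 / (p : ℝ) * (p : ℝ) ^ (-s) = (p : ℝ) ^ (-(1 + s)) := by
      rw [neg_add, Real.rpow_add hp0, Real.rpow_neg_one, one_div]
    calc 1 / (p : ℝ) * ((p : ℝ) ^ (-s) + ((p : ℝ) ^ (-s) + (p : ℝ) ^ (-s) * (p : ℝ) ^ (-s)))
        ≤ 1 / (p : ℝ) * ((p : ℝ) ^ (-s) + ((p : ℝ) ^ (-s) + (p : ℝ) ^ (-s))) := by gcongr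
      _ = 3 * (p : ℝ) ^ (-(1 + s)) := by rw [← hkey]; ring
  have hsmall : ∑ Y ∈ univ.filter (fun Y => #(projPattern Y) ≤ 1), T Y ≤ 1 + 3 * m * (p : ℝ) ^ (-(1 + s)) := by
    rw [hset, sum_insert hnotin, sum_biUnion hdisj]
    have hT0' : T ∅ = 1 := by simp [T, localDensity₀_empty]
    rw [hT0']
    calc 1 + ∑ j, ∑ Y ∈ (univ : Finset (Finset (Fin m ⊕ Fin m))).filter (fun Y => projPattern Y = {j}), T Y
        ≤ 1 + ∑ _j : Fin m, 3 * (p : ℝ) ^ (-(1 + s)) := by gcongr with j; exact hfib j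
      _ = 1 + 3 * m * (p : ℝ) ^ (-(1 + s)) := by rw [sum_const, card_univ, Fintype.card_fin, nsmul_eq_mul]; ring
  -- the large patterns
  have hlarge : ∑ Y ∈ univ.filter (fun Y => ¬ #(projPattern Y) ≤ 1), T Y ≤ 4 ^ m / (p : ℝ) ^ 2 := by
    have hb : ∀ Y ∈ (univ : Finset (Finset (Fin m ⊕ Fin m))).filter (fun Y => ¬ #(projPattern Y) ≤ 1),
        T Y ≤ 1 / (p : ℝ) ^ 2 := by
      intro Y hY
      have hcard : 1 < #(projPattern Y) := not_le.1 (mem_filter.1 hY).2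
      obtain ⟨i, hi, i', hi', hii'⟩ := one_lt_card.1 hcard
      obtain ⟨j₀, j₁, hj, hM⟩ := hmin i i' hii'
      have hω := localDensity_le_of_minor hpW L b hi hi' hj hM
      rw [← localDensity₀_eq] at hω
      calc T Y ≤ 1 / (p : ℝ) ^ 2 * 1 :=
            mul_le_mul hω (prod_le_one (fun _ _ => hps0) fun _ _ => hps) (prod_nonneg fun _ _ => hps0)
              (by positivity)
        _ = 1 / (p : ℝ) ^ 2 := mul_one _
    calc ∑ Y ∈ univ.filter (fun Y => ¬ #(projPattern Y) ≤ 1), T Y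
        ≤ ∑ _Y ∈ univ.filter (fun Y => ¬ #(projPattern Y) ≤ 1), 1 / (p : ℝ) ^ 2 := sum_le_sum hb
      _ = #((univ : Finset (Finset (Fin m ⊕ Fin m))).filter (fun Y => ¬ #(projPattern Y) ≤ 1)) * (1 / (p : ℝ) ^ 2) := by
          rw [sum_const, nsmul_eq_mul]
      _ ≤ (4 : ℝ) ^ m * (1 / (p : ℝ) ^ 2) := by
          gcongr
          calc (#((univ : Finset (Finset (Fin m ⊕ Fin m))).filter (fun Y => ¬ #(projPattern Y) ≤ 1)) : ℝ)
              ≤ #(univ : Finset (Finset (Fin m ⊕ Fin m))) := by exact_mod_cast card_filter_le _ _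
            _ = (4 : ℝ) ^ m := by
                rw [card_univ, Fintype.card_finset, Fintype.card_sum, Fintype.card_fin]
                push_cast
                rw [← two_mul, pow_mul]; norm_num
      _ = 4 ^ m / (p : ℝ) ^ 2 := by ring
  rw [hsplit]
  linarith

end Literature.NumberTheory.Sieve.CFZ
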